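import Literature.Analysis.FluidPDE.HardSphereFlowRegular
import Summits.AtomisticToContinuum.HydrodynamicLimit.Theorems.AntiMazurCoboundariesKineticWindowGronwallBoostFlow
import HarnessLib

/-!
# Galilean boosts of hard-sphere flows on the torus (helper, layer 3: the canonical flow; the a.e. form for every flow)

Crux `Summit.AtomisticToContinuum.HydrodynamicLimit.Theses.AntiMazurCoboundaries.KineticWindowGronwall`
(stmt-AtomisticToContinuum-9282), line `dlr-block-transfer` v6, helper toward the stub `stub_boostFlow` of the lead's
stub `stub_frameCovariance`. Layer 2 (`…KineticWindowGronwallBoostFlow`) constructs the boosted flow `boost Φ u _`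
of a hard-sphere flow `Φ` on `𝕋ᵈ` WHOSE GOOD SET IS INVARIANT UNDER ALL POSITION TRANSLATIONS, and explains why
this hypothesis cannot be dropped for the abstract structure `HardSphereFlow`. This file discharges the hypothesis
for the CANONICAL flow and derives the unconditional almost-everywhere form for every flow:

* TRANSLATION COVARIANCE OF ALEXANDER'S CONSTRUCTION (`HardSphereFlowConstruction`) on the torus: the free exit
  time, the incoming contact pairs, the collision step, the post-collisional states, simple incoming
  configurations, forward goodness and the good set `Alexander.good` are invariant / covariant under
  `(x_i, v_i)_i ↦ (x_i + a, v_i)_i` (`freeExitTime_posShift`, …, `posShift_mem_alexanderGood_iff`; the translation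
  analogue of the relabelling invariance `HardSphereFlowPerm`, simpler because the ORDERED incoming pairs are
  literally unchanged, so no goodness hypothesis is needed for the collision step);
* hence the regularised canonical flow `Alexander.regHardSphereFlow hε hε' N` (`HardSphereFlowRegular`,
  `0 < ε < 1/2`, good set `Alexander.good`) has a translation-invariant good set (`regHardSphereFlow_good_posShift`)
  and its boost `boostReg hε hε' N u := boost (regHardSphereFlow hε hε' N) u _` is an honest hard-sphere flow;
* EVERY hard-sphere flow `Φ` on `𝕋ᵈ` (`0 < ε < 1/2`) agrees with the canonical one Liouville-a.e. SIMULTANEOUSLY AT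
  ALL FORWARD TIMES (`ae_forall_flow_eq_regFlow`: on `Φ.good ∩ Alexander.good` both orbits are hard-sphere
  trajectories from the same datum, forward uniqueness `IsHardSphereTrajectory.unique_holds`), and at each fixed
  time (`HardSphereFlow.flow_ae_eq_regFlow`);
* so `Ψ := boostReg hε hε' N u` satisfies `Ψ_t z = boostAt u t (Φ_t (boostAt (-u) 0 z))` for Liouville-a.e. `z`
  simultaneously for all `t ≥ 0` (`ae_boostReg_flow_eq`) and, for each `t`, Liouville-a.e. (`boostReg_flow_ae_eq`):
  the statement `BoostFlowAE`, proved (`boostFlowAE`), and the frame-covariance dictionary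
  `ae_flow_boostAt_eq : Φ_t (boostAt u 0 w) = boostAt u t ((boostReg … (-u))_t w)` for a.e. `w`, all `t ≥ 0` —
  the orbit of ANY flow from boosted data is the boosted orbit of a hard-sphere flow in the rest frame, which is
  what the transfer of the kinetic window bound between Galilean frames consumes (laws `≪` Liouville).
-/

noncomputable section

open Set Filter Function MeasureTheory
open scoped ENNReal
open Literature.Analysis
open Literature.Analysis.FluidPDE

namespace Summit.AtomisticToContinuum.HydrodynamicLimit.Theorems.KineticWindowGronwallBoost

/-! ### Translation covariance of Alexander's construction on the torus -/

section Construction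

variable {d : Type*} [Fintype d] {N : ℕ} {ε : ℝ}

/-- Outgoing pairs are unchanged by a common translation of all positions. [folklore] -/
theorem isOutgoing_posShift_iff (a : UnitAddTorus d) (z : Config N d (UnitAddTorus d)) (i j : Fin N) :
    IsOutgoing (Torus.geometry d) (fun i => ((z i).1 + a, (z i).2) : Config N d (UnitAddTorus d)) i j ↔
      IsOutgoing (Torus.geometry d) z i j := by
  simp only [IsOutgoing, Torus.geometry_sepVec_add_right]

/-- **The free exit time is translation invariant.** [folklore] -/
theorem freeExitTime_posShift (a : UnitAddTorus d) (z : Config N d (UnitAddTorus d)) :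
    Alexander.freeExitTime (Torus.geometry d) ε (fun i => ((z i).1 + a, (z i).2) : Config N d (UnitAddTorus d)) =
      Alexander.freeExitTime (Torus.geometry d) ε z := by
  unfold Alexander.freeExitTime
  congr 1
  ext t
  simp only [mem_setOf_eq, freeFlight_posShift, posShift_mem_hardSphereDomain_iff]

/-- **The ordered incoming contact pairs are translation invariant.** [folklore] -/
theorem incomingPairs_posShift (a : UnitAddTorus d) (z : Config N d (UnitAddTorus d)) :
    Alexander.incomingPairs (Torus.geometry d) ε (fun i => ((z i).1 + a, (z i).2) : Config N d (UnitAddTorus d)) =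
      Alexander.incomingPairs (Torus.geometry d) ε z := by
  ext p
  simp only [Alexander.mem_incomingPairs, posShift_mem_contactSet_iff, isIncoming_posShift_iff]

/-- **The collision step is translation covariant** (unconditionally: the exit time, the exit configuration's
ordered incoming pairs and hence the selected pair are unchanged, and the reflection commutes with the
translation). [folklore] -/
theorem collisionStep_posShift (a : UnitAddTorus d) (z : Config N d (UnitAddTorus d)) :
    Alexander.collisionStep (Torus.geometry d) ε (fun i => ((z i).1 + a, (z i).2) : Config N d (UnitAddTorus d)) =
      fun i => ((Alexander.collisionStep (Torus.geometry d) ε z i).1 + a,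
        (Alexander.collisionStep (Torus.geometry d) ε z i).2) := by
  by_cases htop : Alexander.freeExitTime (Torus.geometry d) ε z = ∞
  · rw [Alexander.collisionStep_of_eq_top htop,
      Alexander.collisionStep_of_eq_top (by rw [freeExitTime_posShift]; exact htop)]
  · have htop' : Alexander.freeExitTime (Torus.geometry d) ε
        (fun i => ((z i).1 + a, (z i).2) : Config N d (UnitAddTorus d)) ≠ ∞ := by
      rw [freeExitTime_posShift]; exact htop
    simp only [Alexander.collisionStep, htop, htop', if_false]
    rw [freeExitTime_posShift, freeFlight_posShift, incomingPairs_posShift]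
    by_cases hne : (Alexander.incomingPairs (Torus.geometry d) ε
        (freeFlight (Torus.geometry d) (Alexander.freeExitTime (Torus.geometry d) ε z).toReal z)).Nonempty
    · rw [dif_pos hne, dif_pos hne, collidePair_posShift (ne_of_lt (Alexander.mem_incomingPairs.1 hne.some_mem).1)]
    · rw [dif_neg hne, dif_neg hne]

/-- **The post-collisional states are translation covariant.** [folklore] -/
theorem stateAfter_posShift (a : UnitAddTorus d) (z : Config N d (UnitAddTorus d)) (k : ℕ) :
    Alexander.stateAfter (Torus.geometry d) ε (fun i => ((z i).1 + a, (z i).2) : Config N d (UnitAddTorus d)) k =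
      fun i => ((Alexander.stateAfter (Torus.geometry d) ε z k i).1 + a,
        (Alexander.stateAfter (Torus.geometry d) ε z k i).2) := by
  induction k with
  | zero => rfl
  | succ k ih => rw [Alexander.stateAfter_succ, Alexander.stateAfter_succ, ih, collisionStep_posShift]

/-- **Simple incoming configurations are translation invariant.** [folklore] -/
theorem isSimpleIncoming_posShift_iff (a : UnitAddTorus d) (z : Config N d (UnitAddTorus d)) :
    Alexander.IsSimpleIncoming (Torus.geometry d) ε (fun i => ((z i).1 + a, (z i).2) : Config N d (UnitAddTorus d)) ↔
      Alexander.IsSimpleIncoming (Torus.geometry d) ε z := by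
  simp only [Alexander.IsSimpleIncoming, isIncoming_posShift_iff, posShift_mem_contactSet_iff]

/-- **Forward goodness is translation invariant.** [folklore] -/
theorem fwdGood_posShift_iff (a : UnitAddTorus d) (z : Config N d (UnitAddTorus d)) :
    Alexander.FwdGood (Torus.geometry d) ε (fun i => ((z i).1 + a, (z i).2) : Config N d (UnitAddTorus d)) ↔
      Alexander.FwdGood (Torus.geometry d) ε z := by
  simp only [Alexander.FwdGood, stateAfter_posShift, freeExitTime_posShift, freeFlight_posShift,
    isSimpleIncoming_posShift_iff, posShift_mem_contactSet_iff]

/-- **Alexander's good set `Γ₀` on the torus is translation invariant**: membership — hard-sphere domain, the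
contact clause at time `0`, forward goodness of `z` and of `flipVel z` — is preserved by a common translation of
all positions (every ingredient of the construction only sees separation vectors and relative velocities).
[folklore] -/
theorem posShift_mem_alexanderGood_iff (a : UnitAddTorus d) (z : Config N d (UnitAddTorus d)) :
    (fun i => ((z i).1 + a, (z i).2) : Config N d (UnitAddTorus d)) ∈ Alexander.good (Torus.geometry d) ε ↔
      z ∈ Alexander.good (Torus.geometry d) ε := by
  have hflip : flipVel (fun i => ((z i).1 + a, (z i).2) : Config N d (UnitAddTorus d)) =
      fun i => ((flipVel z i).1 + a, (flipVel z i).2) := rfl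
  simp only [Alexander.good, mem_setOf_eq, posShift_mem_hardSphereDomain_iff, posShift_mem_contactSet_iff,
    isOutgoing_posShift_iff, fwdGood_posShift_iff, hflip]

end Construction

/-! ### The boosted canonical flow -/

section Canonical

variable {d : Type*} [Fintype d] {N : ℕ} {ε : ℝ}

/-- The good set of the regularised canonical flow (`Alexander.good`) is invariant under all position
translations. [folklore] -/
theorem regHardSphereFlow_good_posShift (hε : 0 < ε) (hε' : ε < 2⁻¹) (N : ℕ) (a : UnitAddTorus d)
    (z : Config N d (UnitAddTorus d)) (hz : z ∈ (Alexander.regHardSphereFlow (d := d) hε hε' N).good) :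
    (fun i => ((z i).1 + a, (z i).2) : Config N d (UnitAddTorus d)) ∈ (Alexander.regHardSphereFlow hε hε' N).good := by
  rw [Alexander.regHardSphereFlow_good] at hz ⊢
  exact (posShift_mem_alexanderGood_iff a z).2 hz

/-- **THE BOOSTED CANONICAL HARD-SPHERE FLOW** on `𝕋ᵈ` (`0 < ε < 1/2`): the Galilean boost by `u` of the
regularised Alexander flow, `(boostReg hε hε' N u)_t = boostAt u t ∘ regFlow_t ∘ boostAt (-u) 0`, an honest
`HardSphereFlow` (layer 2's `boost`, the translation invariance of `Alexander.good` discharging its hypothesis). -/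
def boostReg (hε : 0 < ε) (hε' : ε < 2⁻¹) (N : ℕ) (u : EuclideanSpace ℝ d) : HardSphereFlow (Torus.geometry d) ε N :=
  boost (Alexander.regHardSphereFlow hε hε' N) u fun a z hz => regHardSphereFlow_good_posShift hε hε' N a z hz

/-- The flow map of the boosted canonical flow. [folklore] -/
@[simp]
theorem boostReg_flow (hε : 0 < ε) (hε' : ε < 2⁻¹) (u : EuclideanSpace ℝ d) (t : ℝ) (z : Config N d (UnitAddTorus d)) :
    (boostReg (d := d) hε hε' N u).flow t z =
      boostAt u t (Alexander.regFlow (Torus.geometry d) ε t (boostAt (-u) 0 z)) := rfl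

/-- The good set of the boosted canonical flow. [folklore] -/
theorem boostReg_good (hε : 0 < ε) (hε' : ε < 2⁻¹) (u : EuclideanSpace ℝ d) :
    (boostReg (d := d) hε hε' N u).good = boostAt (-u) 0 ⁻¹' Alexander.good (Torus.geometry d) ε := rfl

/-- The good set of the boosted canonical flow, image form. [folklore] -/
theorem boostReg_good_eq_image (hε : 0 < ε) (hε' : ε < 2⁻¹) (u : EuclideanSpace ℝ d) :
    (boostReg (d := d) hε hε' N u).good = boostAt u 0 '' Alexander.good (Torus.geometry d) ε := by
  rw [boostReg_good, image_boostAt_eq_preimage]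

/-- Conjugation identity for the boosted canonical flow. [folklore] -/
theorem boostReg_flow_boostAt (hε : 0 < ε) (hε' : ε < 2⁻¹) (u : EuclideanSpace ℝ d) (t : ℝ) (z : Config N d (UnitAddTorus d)) :
    (boostReg (d := d) hε hε' N u).flow t (boostAt u 0 z) = boostAt u t (Alexander.regFlow (Torus.geometry d) ε t z) := by
  rw [boostReg_flow, boostAt_neg_boostAt]

/-! ### Every flow is the canonical flow almost everywhere, at all forward times at once -/

/-- **Every hard-sphere flow on `𝕋ᵈ` agrees with the regularised canonical flow Liouville-a.e. simultaneously at
all forward times** (`0 < ε < 1/2`): on the conull set `Φ.good ∩ Alexander.good` both orbits are hard-sphere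
trajectories issued from the same datum, so they coincide on `[0, ∞)` by forward uniqueness
(`IsHardSphereTrajectory.unique_holds`; GST 2013 Prop. 4.1.1). [folklore] -/
theorem ae_forall_flow_eq_regFlow (hε : 0 < ε) (hε' : ε < 2⁻¹) (Φ : HardSphereFlow (Torus.geometry d) ε N) :
    ∀ᵐ z ∂liouville (Torus.geometry d) N ε, ∀ t : ℝ, 0 ≤ t →
      Φ.flow t z = Alexander.regFlow (Torus.geometry d) ε t z := by
  filter_upwards [Φ.ae_mem_good, (Alexander.regHardSphereFlow (d := d) hε hε' N).ae_mem_good] with z hz hz'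
  intro t ht
  have h0 : Φ.flow 0 z = (Alexander.regHardSphereFlow (d := d) hε hε' N).flow 0 z := by
    rw [Φ.flow_zero z hz, (Alexander.regHardSphereFlow hε hε' N).flow_zero z hz']
  exact IsHardSphereTrajectory.unique_holds (Φ.isTrajectory z hz)
    ((Alexander.regHardSphereFlow hε hε' N).isTrajectory z hz') h0 (Set.mem_Ici.2 ht)

/-- **The boosted canonical flow is the boost-conjugate of every flow, a.e., at all forward times at once**:
for Liouville-a.e. `z`, `(boostReg … u)_t z = boostAt u t (Φ_t (boostAt (-u) 0 z))` for all `t ≥ 0`. [folklore] -/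
theorem ae_boostReg_flow_eq (hε : 0 < ε) (hε' : ε < 2⁻¹) (Φ : HardSphereFlow (Torus.geometry d) ε N) (u : EuclideanSpace ℝ d) :
    ∀ᵐ z ∂liouville (Torus.geometry d) N ε, ∀ t : ℝ, 0 ≤ t →
      (boostReg (d := d) hε hε' N u).flow t z = boostAt u t (Φ.flow t (boostAt (-u) 0 z)) := by
  have h := (measurePreserving_boostAt_liouville (N := N) ε (-u) 0).quasiMeasurePreserving.ae
    (ae_forall_flow_eq_regFlow hε hε' Φ)
  filter_upwards [h] with z hz t ht
  rw [boostReg_flow, ← hz t ht]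

/-- **The same at each fixed time (all `t ∈ ℝ`)**: `(boostReg … u)_t = boostAt u t ∘ Φ_t ∘ boostAt (-u) 0`
Liouville-a.e. (`HardSphereFlow.flow_ae_eq_regFlow`). [folklore] -/
theorem boostReg_flow_ae_eq (hε : 0 < ε) (hε' : ε < 2⁻¹) (Φ : HardSphereFlow (Torus.geometry d) ε N) (u : EuclideanSpace ℝ d) (t : ℝ) :
    (boostReg (d := d) hε hε' N u).flow t =ᵐ[liouville (Torus.geometry d) N ε]
      fun z => boostAt u t (Φ.flow t (boostAt (-u) 0 z)) := by
  have h := (measurePreserving_boostAt_liouville (N := N) ε (-u) 0).quasiMeasurePreserving.ae_eq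
    (Φ.flow_ae_eq_regFlow hε hε' t)
  filter_upwards [h] with z hz
  rw [Function.comp_apply, Function.comp_apply] at hz
  rw [boostReg_flow, ← hz]

/-- **Frame-covariance dictionary**: for every flow `Φ` and Liouville-a.e. datum `w`, the orbit of `Φ` from the
velocity-translated datum `boostAt u 0 w` is, at all forward times, the boosted orbit of the hard-sphere flow
`boostReg … (-u)` from `w`: `Φ_t (boostAt u 0 w) = boostAt u t ((boostReg … (-u))_t w)`. [folklore] -/
theorem ae_flow_boostAt_eq (hε : 0 < ε) (hε' : ε < 2⁻¹) (Φ : HardSphereFlow (Torus.geometry d) ε N) (u : EuclideanSpace ℝ d) :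
    ∀ᵐ w ∂liouville (Torus.geometry d) N ε, ∀ t : ℝ, 0 ≤ t →
      Φ.flow t (boostAt u 0 w) = boostAt u t ((boostReg (d := d) hε hε' N (-u)).flow t w) := by
  filter_upwards [ae_boostReg_flow_eq hε hε' Φ (-u)] with w hw t ht
  rw [hw t ht, boostAt_boostAt_neg, neg_neg]

/-- The same dictionary under any law absolutely continuous with respect to the Liouville measure (e.g. a local
Gibbs law `liouville.withDensity _`). [folklore] -/
theorem ae_flow_boostAt_eq_of_absolutelyContinuous (hε : 0 < ε) (hε' : ε < 2⁻¹) (Φ : HardSphereFlow (Torus.geometry d) ε N)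
    (u : EuclideanSpace ℝ d) {P : Measure (Config N d (UnitAddTorus d))}
    (hP : P ≪ liouville (Torus.geometry d) N ε) :
    ∀ᵐ w ∂P, ∀ t : ℝ, 0 ≤ t →
      Φ.flow t (boostAt u 0 w) = boostAt u t ((boostReg (d := d) hε hε' N (-u)).flow t w) :=
  hP (ae_flow_boostAt_eq hε hε' Φ u)

end Canonical

/-! ### The statement: the a.e. form for every flow -/

/-- **GALILEAN BOOSTS OF HARD-SPHERE FLOWS ON THE TORUS (almost-everywhere form, every flow).** For
`0 < ε < 1/2`, every hard-sphere flow `Φ` on `𝕋ᵈ` (`N` particles, ARBITRARY good set and junk values) and every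
`u ∈ ℝᵈ` there is a hard-sphere flow `Ψ` (same geometry and diameter) with `Ψ_t = boostAt u t ∘ Φ_t ∘ boostAt (-u) 0`
Liouville-a.e. for each `t`, and `Ψ_t z = boostAt u t (Φ_t (boostAt (-u) 0 z))` for Liouville-a.e. `z` simultaneously
for all `t ≥ 0` (witness: the boosted canonical flow `boostReg`). This is the unconditional TRUE form of the lead's
registered `BoostFlow`. Folklore (Galilean invariance + Alexander's theorem + forward uniqueness). -/
def BoostFlowAE : Prop :=
  ∀ {d : Type*} [Fintype d] {ε : ℝ} {N : ℕ}, 0 < ε → ε < 2⁻¹ →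
    ∀ (Φ : HardSphereFlow (Torus.geometry d) ε N) (u : EuclideanSpace ℝ d),
    ∃ Ψ : HardSphereFlow (Torus.geometry d) ε N,
      (∀ t : ℝ, Ψ.flow t =ᵐ[liouville (Torus.geometry d) N ε] fun z => boostAt u t (Φ.flow t (boostAt (-u) 0 z))) ∧
      (∀ᵐ z ∂liouville (Torus.geometry d) N ε, ∀ t : ℝ, 0 ≤ t →
        Ψ.flow t z = boostAt u t (Φ.flow t (boostAt (-u) 0 z)))

/-- **Layer 3, proved**: `boostFlowAE` (witness `boostReg hε hε' N u`). [folklore] -/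
theorem boostFlowAE : BoostFlowAE := by
  intro d _ ε N hε hε' Φ u
  exact ⟨boostReg hε hε' N u, boostReg_flow_ae_eq hε hε' Φ u, ae_boostReg_flow_eq hε hε' Φ u⟩

end Summit.AtomisticToContinuum.HydrodynamicLimit.Theorems.KineticWindowGronwallBoost

end
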